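import Mathlib.MeasureTheory.Function.SpecialFunctions.Basic
import Summits.AnomalousDissipation.AnomalousDissipation.Theorems.BaireTransferDenseLoudDesignerForcesErgodicLine
import Summits.AnomalousDissipation.AnomalousDissipation.Theorems.BaireTransferDenseLoudDesignerForcesStubBirkhoffMeans
import Summits.AnomalousDissipation.AnomalousDissipation.Theorems.BaireTransferDenseLoudDesignerForcesStubTrajectoryPowerBudget
import HarnessLib

/-!
# Stub `stub_genericLoudPoint` of the line `SketchIdeator2` (card `separatrix-flux-pinning`)
# (crux `MarginalStabilityChain.ChainRealisation`, stmt-AnomalousDissipation-14249)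

Sorry-free discharge of the registered stub `stub_genericLoudPoint` (E2b) of the lead's skeleton
(`Cruxes/ChainRealisation/Lines/SketchIdeator2.lean`) over the landed ergodic vocabulary of
`Theorems/BaireTransferDenseLoudDesignerForcesErgodicLine.lean` (namespace
`…Theorems.DenseLoudDesignerForces.Ergodic`: `Hsp`, `energyAvg`, `dissipAvg`, `IsNSPhase`,
`IsInvariantMeasure`, `budget_selection`).

**Statement (GENERIC LOUD POINT).**  Let `(K, φ)` be an NS phase for the steady force `F` at viscosity `ν` and
`μ` an invariant probability measure carried by `K` with ensemble dissipation `≥ ε > 0` and ensemble energy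
`≤ E`.  Then some `y ∈ K` has a COMPLETE BACKWARD CHAIN in `K` (`y ∈ φₙ(K)` for every `n : ℕ`) and CONVERGENT
forward trajectory means of dissipation and energy, with limits `d ≥ ε/2` and `e ≤ 16‖F‖₂² max(E,1)²/ε²`.

**Proof.**
* Birkhoff means (`stub_birkhoffMeans`, landed): measurable integrable `En ≥ 0`, `D` with `∫ En = ensembleEnergy μ`,
  `∫ D = ensembleDissipation ν μ` and `μ`-a.e. convergence of the trajectory means to `En x`, `D x`.
* Trajectory power budget (`stub_trajectoryPowerBudget`, landed; Doering–Foias 2002 §2: energy equality of the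
  classical trajectory + Cauchy–Schwarz in space-time): at every `x ∈ K` with convergent means,
  `D x ≤ ‖F‖₂ √(En x)`.  Hence the truncation `D' = min D (‖F‖₂ √En)` equals `D` a.e., obeys the budget
  everywhere, and `‖F‖₂ > 0` (otherwise `∫ D' ≤ 0 < ε`).
* Budget selection (`budget_selection`, landed: Markov + Cauchy–Schwarz) with the energy ceiling `max E 1 > 0`:
  the cell `{En ≤ 16‖F‖₂² max(E,1)²/ε² ∧ ε/2 ≤ D'}` has positive `μ`-measure.
* Invariant measures are carried by `⋂ₙ φₙ(K)`: `φₙ(K)` is compact (continuous image), and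
  `μ(φₙ(K)ᶜ) = μ(φₙ⁻¹(φₙ(K)ᶜ)) ≤ μ(Kᶜ) = 0` by `(φₙ)_* μ = μ`.
* A set of positive measure meets the intersection of countably many full-measure sets
  (`Measure.exists_mem_of_measure_ne_zero_of_ae`): pick `y` there.

References: C. R. Doering, C. Foias, *Energy dissipation in body-forced turbulence*, J. Fluid Mech. 467 (2002)
§2; Foias–Manley–Rosa–Temam, *Navier–Stokes Equations and Turbulence* (CUP 2001) Ch. IV §2 (invariant measures
are carried by the complete trajectories), Ch. V §1 (time vs ensemble averages).
-/

set_option linter.dupNamespace false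

noncomputable section

open MeasureTheory Set Filter Topology
open scoped InnerProductSpace
open Literature.Analysis.FunctionSpaces Literature.Analysis.FunctionSpaces.Torus
open Literature.Analysis.FluidPDE

namespace Summit.AnomalousDissipation.AnomalousDissipation.Theorems.ChainRealisation.SeparatrixFluxPinning

open Summit.AnomalousDissipation.AnomalousDissipation.Theorems.DenseLoudDesignerForces.Ergodic
open Literature.Analysis.FluidPDE.Torus

/-- Local notation: the torus `T³`. -/
local notation "𝕋³" => UnitAddTorus (Fin 3)
/-- Local notation: velocity values. -/
local notation "E³" => EuclideanSpace ℝ (Fin 3)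
/-- Local notation: the planar torus `T²`. -/
local notation "𝕋²" => UnitAddTorus (Fin 2)
/-- Local notation: planar velocity values. -/
local notation "E²" => EuclideanSpace ℝ (Fin 2)

/-! ## Invariant measures are carried by the images `φₜ(K)` -/

section Carried

variable {ν : ℝ} {F : 𝕋³ → E³} {K : Set Hsp} {φ : ℝ → Hsp → Hsp} {μ : Measure Hsp}

/-- The time-`t` map of the semiflow (`t ≥ 0`) is `μ`-a.e. measurable for an invariant measure `μ`: otherwise
`Measure.map (φ t) μ = 0 ≠ μ`. -/
theorem stub_genericLoudPoint_aux_aemeasurable (hμ : IsInvariantMeasure K φ μ) {t : ℝ} (ht : 0 ≤ t) :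
    AEMeasurable (φ t) μ := by
  haveI := hμ.prob
  by_contra h
  have h0 := Measure.map_of_not_aemeasurable h
  rw [hμ.map_eq t ht] at h0
  exact IsProbabilityMeasure.ne_zero μ h0

/-- The time-`t` map of an NS phase (`t ≥ 0`) is continuous on `K`. -/
theorem stub_genericLoudPoint_aux_continuousOn (hK : IsNSPhase ν F K φ) {t : ℝ} (ht : 0 ≤ t) :
    ContinuousOn (φ t) K := by
  have h0 : Continuous fun y : Hsp => ((t, y) : ℝ × Hsp) := by fun_prop
  exact hK.continuousOn.comp h0.continuousOn fun y hy => ⟨ht, hy⟩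

/-- An invariant measure carried by `K` is carried by every image `φₜ(K)`, `t ≥ 0`: the image is compact, hence
Borel, and `μ(φₜ(K)ᶜ) = μ(φₜ⁻¹(φₜ(K)ᶜ)) ≤ μ(Kᶜ) = 0` by invariance. -/
theorem stub_genericLoudPoint_aux_ae_mem_image (hK : IsNSPhase ν F K φ) (hμ : IsInvariantMeasure K φ μ)
    {t : ℝ} (ht : 0 ≤ t) : ∀ᵐ x ∂μ, x ∈ φ t '' K := by
  have hc : IsCompact (φ t '' K) :=
    hK.isCompact.image_of_continuousOn (stub_genericLoudPoint_aux_continuousOn hK ht)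
  have hm : MeasurableSet (φ t '' K)ᶜ := hc.isClosed.measurableSet.compl
  have h1 : μ (φ t '' K)ᶜ = μ (φ t ⁻¹' (φ t '' K)ᶜ) := by
    conv_lhs => rw [← hμ.map_eq t ht]
    exact Measure.map_apply_of_aemeasurable (stub_genericLoudPoint_aux_aemeasurable hμ ht) hm
  have h2 : φ t ⁻¹' (φ t '' K)ᶜ ⊆ Kᶜ := by
    rw [preimage_compl, compl_subset_compl]
    exact subset_preimage_image _ _
  have h3 : μ (φ t '' K)ᶜ = 0 :=
    le_antisymm ((h1.le.trans (measure_mono h2)).trans hμ.null_compl.le) bot_le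
  exact mem_ae_iff.2 h3

/-- `μ`-a.e. point has a complete backward chain in `K` along the integer times. -/
theorem stub_genericLoudPoint_aux_ae_chain (hK : IsNSPhase ν F K φ) (hμ : IsInvariantMeasure K φ μ) :
    ∀ᵐ x ∂μ, ∀ n : ℕ, ∃ z ∈ K, φ n z = x := by
  refine ae_all_iff.2 fun n => ?_
  filter_upwards [stub_genericLoudPoint_aux_ae_mem_image hK hμ (Nat.cast_nonneg n)] with x hx
  obtain ⟨z, hz, hzx⟩ := hx
  exact ⟨z, hz, hzx⟩

end Carried

/-! ## The stub -/

/-- **Stub E2b of the line `SketchIdeator2`: GENERIC LOUD POINT.**  An invariant probability measure on an NS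
phase with ensemble dissipation `≥ ε > 0` and ensemble energy `≤ E` has a point `y ∈ K` with a COMPLETE backward
chain in `K` whose forward trajectory means CONVERGE, to a dissipation `≥ ε/2` and an energy
`≤ 16‖F‖₂² max(E,1)²/ε²` (Birkhoff means `stub_birkhoffMeans`; the trajectory power budget `D ≤ ‖F‖₂√En`,
`stub_trajectoryPowerBudget`, Doering–Foias 2002 §2; `budget_selection`; invariant measures are carried by
`⋂ₙ φₙ(K)`, Foias–Manley–Rosa–Temam 2001 Ch. IV §2). -/
theorem stub_genericLoudPoint :
    ∀ (ν : ℝ) (F : 𝕋³ → E³) (K : Set Hsp) (φ : ℝ → Hsp → Hsp) (μ : Measure Hsp) (E ε : ℝ),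
      0 < ν → IsSmooth F → HasZeroMean F → IsNSPhase ν F K φ → IsInvariantMeasure K φ μ →
      0 < ε → ε ≤ ensembleDissipation ν μ → ensembleEnergy μ ≤ E →
      ∃ y ∈ K, (∀ n : ℕ, ∃ z ∈ K, φ n z = y) ∧ ∃ d e : ℝ,
        Tendsto (dissipAvg ν φ y) atTop (nhds d) ∧ Tendsto (energyAvg φ y) atTop (nhds e) ∧
        ε / 2 ≤ d ∧ e ≤ 16 * (∫ x, ‖F x‖ ^ 2) * (max E 1) ^ 2 / ε ^ 2 := by
  intro ν F K φ μ E ε _hν _hF _hF0 hK hμ hε hεD hEE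
  haveI := hμ.prob
  obtain ⟨En, D, hEnm, hDm, hEn0, hEni, hDi, hEnI, hDI, hlim⟩ := stub_birkhoffMeans hK hμ
  have hA0 : 0 ≤ ∫ x, ‖F x‖ ^ 2 := integral_nonneg fun _ => sq_nonneg _
  obtain ⟨F₂, hF₂⟩ : ∃ F₂ : ℝ, F₂ = Real.sqrt (∫ x, ‖F x‖ ^ 2) := ⟨_, rfl⟩
  have hF₂sq : F₂ ^ 2 = ∫ x, ‖F x‖ ^ 2 := by rw [hF₂, Real.sq_sqrt hA0]
  -- the truncated dissipation obeys the power budget everywhere and equals `D` almost everywhere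
  obtain ⟨D', hD'⟩ : ∃ D' : Hsp → ℝ, D' = fun x => min (D x) (F₂ * Real.sqrt (En x)) := ⟨_, rfl⟩
  have hD'm : Measurable D' := by
    rw [hD']
    exact hDm.min (hEnm.sqrt.const_mul F₂)
  have hpow : ∀ x, D' x ≤ F₂ * Real.sqrt (En x) := fun x => by
    rw [hD']
    exact min_le_right _ _
  have hae : D' =ᵐ[μ] D := by
    filter_upwards [hlim, hμ.ae_mem] with x hx hxK
    rw [hD']
    refine min_eq_left ?_
    rw [hF₂]
    exact stub_trajectoryPowerBudget hK hxK hx.1 hx.2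
  have hD'i : Integrable D' μ := hDi.congr hae.symm
  have hD'I : ε ≤ ∫ x, D' x ∂μ := by
    rw [integral_congr_ae hae, hDI]
    exact hεD
  have hEnI' : ∫ x, En x ∂μ ≤ max E 1 := by
    rw [hEnI]
    exact hEE.trans (le_max_left _ _)
  -- the force is not zero
  have hF₂pos : 0 < F₂ := by
    by_contra h
    have hF0 : F₂ = 0 := le_antisymm (not_lt.1 h) (by rw [hF₂]; exact Real.sqrt_nonneg _)
    have h1 : ∫ x, D' x ∂μ ≤ 0 := by
      refine integral_nonpos fun x => ?_
      calc D' x ≤ F₂ * Real.sqrt (En x) := hpow x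
        _ = 0 := by rw [hF0, zero_mul]
    linarith
  -- budget selection: the loud bounded-energy cell has positive measure
  have hsel := budget_selection μ hD'm hEnm hEn0 hF₂pos (lt_max_of_lt_right one_pos : (0 : ℝ) < max E 1) hε
    hpow hD'i hEni hD'I hEnI'
  have hBpos : μ {x | En x ≤ 16 * F₂ ^ 2 * (max E 1) ^ 2 / ε ^ 2 ∧ ε / 2 ≤ D' x} ≠ 0 := by
    have h1 : 0 < ENNReal.ofReal (ε ^ 2 / (16 * F₂ ^ 2 * max E 1)) := ENNReal.ofReal_pos.2 (by positivity)
    exact (h1.trans_le hsel).ne'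
  -- pick a generic point of the cell
  obtain ⟨y, hyB, hyK, hylim, hyD, hych⟩ := Measure.exists_mem_of_measure_ne_zero_of_ae hBpos
    (ae_restrict_of_ae (hμ.ae_mem.and (hlim.and (hae.and (stub_genericLoudPoint_aux_ae_chain hK hμ)))))
  refine ⟨y, hyK, hych, D y, En y, hylim.2, hylim.1, ?_, ?_⟩
  · have h2 := hyB.2
    rw [hyD] at h2
    exact h2
  · have h3 := hyB.1
    rw [hF₂sq] at h3
    exact h3

end Summit.AnomalousDissipation.AnomalousDissipation.Theorems.ChainRealisation.SeparatrixFluxPinning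

end
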